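import Mathlib
import HarnessLib

/-!
# Gauss–Green between two graphs (the vertical component, via Fubini and the fundamental theorem)

Topic `Literature/MeasureTheory/Integral`; namespace `Literature.MeasureTheory.Integral`.

For a measurable base set `D ⊆ α` (any s-finite measure space `(α, μ)`), measurable heights
`lo ≤ hi` on `D`, and the region between the graphs
`S = {(x, t) | x ∈ D, lo x ≤ t ≤ hi x} ⊆ α × ℝ`, a function `g` whose fibrewise derivative `g'`
(`∂_t g`) is continuous on each fibre and integrable on `S` satisfies
`∫_S ∂_t g d(μ ⊗ λ) = ∫_D (g(x, hi x) − g(x, lo x)) dμ`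
(`setIntegral_deriv_between_graphs`).  This is the `e_{n}`-component of the Gauss–Green formula
(Evans–Gariepy, Thm 5.16) for a vertically simple region, in the elementary form "Fubini + the
fundamental theorem of calculus on each fibre" — the form needed for polytopes (every convex
polytope is vertically simple in every direction, its top and bottom graphs being finite minima /
maxima of affine maps), where no reduced boundary is available in Mathlib.  Also recorded: the
measurability of `S` and the fibre computation.
WHAT THIS IS NOT: the full Gauss–Green theorem (no reduced boundary, no surface measure); the facet
decomposition of the top/bottom graphs of a polytope is a separate step.
-/

noncomputable section

namespace Literature.MeasureTheory.Integral

open _root_.MeasureTheory Set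

/-- The region between two measurable graphs over a measurable base is measurable.
[cite: EvansGariepy2015, Thm 5.16 (Gauss–Green), setting] -/
theorem measurableSet_between_graphs {α : Type*} [MeasurableSpace α] {D : Set α}
    (hD : MeasurableSet D) {lo hi : α → ℝ} (hlo : Measurable lo) (hhi : Measurable hi) :
    MeasurableSet {p : α × ℝ | p.1 ∈ D ∧ lo p.1 ≤ p.2 ∧ p.2 ≤ hi p.1} := by
  have h1 : MeasurableSet {p : α × ℝ | p.1 ∈ D} := hD.preimage measurable_fst
  have h2 : MeasurableSet {p : α × ℝ | lo p.1 ≤ p.2} :=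
    measurableSet_le (hlo.comp measurable_fst) measurable_snd
  have h3 : MeasurableSet {p : α × ℝ | p.2 ≤ hi p.1} :=
    measurableSet_le measurable_snd (hhi.comp measurable_fst)
  simpa only [setOf_and] using h1.inter (h2.inter h3)

/-- The fibre of the region between two graphs: over `x ∈ D` the indicator of the region, as a
function of the height, is the indicator of `[lo x, hi x]`. [cite: EvansGariepy2015, Thm 5.16 (Gauss–Green), setting] -/
theorem indicator_between_graphs_fibre {α : Type*} {D : Set α} {lo hi : α → ℝ} (g : α × ℝ → ℝ)
    {x : α} (hx : x ∈ D) :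
    (fun t => ({p : α × ℝ | p.1 ∈ D ∧ lo p.1 ≤ p.2 ∧ p.2 ≤ hi p.1}).indicator g (x, t)) =
      (Icc (lo x) (hi x)).indicator fun t => g (x, t) := by
  funext t
  by_cases ht : t ∈ Icc (lo x) (hi x)
  · rw [indicator_of_mem ht, indicator_of_mem]
    exact ⟨hx, ht.1, ht.2⟩
  · rw [indicator_of_notMem ht, indicator_of_notMem]
    rintro ⟨-, h1, h2⟩
    exact ht ⟨h1, h2⟩

/-- **Gauss–Green between two graphs (vertical component).**  Let `(α, μ)` be s-finite,
`D ⊆ α` measurable, `lo ≤ hi` measurable on `D`, and `S = {(x,t) | x ∈ D, lo x ≤ t ≤ hi x}`.  If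
`t ↦ g(x,t)` has derivative `g'(x,t)` at every `t ∈ [lo x, hi x]` (`x ∈ D`), `t ↦ g'(x,t)` is
continuous there, and `g'` is integrable on `S`, then `∫_S g' = ∫_D (g(x, hi x) − g(x, lo x)) dμ(x)`.
[cite: EvansGariepy2015, Thm 5.16 (Gauss–Green), vertically simple case via Fubini + FTC] -/
theorem setIntegral_deriv_between_graphs {α : Type*} [MeasurableSpace α] (μ : Measure α)
    [SFinite μ] {D : Set α} (hD : MeasurableSet D) {lo hi : α → ℝ} (hlo : Measurable lo)
    (hhi : Measurable hi) (hle : ∀ x ∈ D, lo x ≤ hi x) {g g' : α × ℝ → ℝ}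
    (hderiv : ∀ x ∈ D, ∀ t ∈ Icc (lo x) (hi x), HasDerivAt (fun s => g (x, s)) (g' (x, t)) t)
    (hcont : ∀ x ∈ D, ContinuousOn (fun t => g' (x, t)) (Icc (lo x) (hi x)))
    (hint : IntegrableOn g' {p : α × ℝ | p.1 ∈ D ∧ lo p.1 ≤ p.2 ∧ p.2 ≤ hi p.1} (μ.prod volume)) :
    ∫ p in {p : α × ℝ | p.1 ∈ D ∧ lo p.1 ≤ p.2 ∧ p.2 ≤ hi p.1}, g' p ∂(μ.prod volume) =
      ∫ x in D, (g (x, hi x) - g (x, lo x)) ∂μ := by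
  set S := {p : α × ℝ | p.1 ∈ D ∧ lo p.1 ≤ p.2 ∧ p.2 ≤ hi p.1} with hS
  have hSm : MeasurableSet S := measurableSet_between_graphs hD hlo hhi
  rw [← integral_indicator (f := g') hSm, integral_prod _ (hint.integrable_indicator hSm),
    show (∫ x in D, (g (x, hi x) - g (x, lo x)) ∂μ) =
      ∫ x, D.indicator (fun x => g (x, hi x) - g (x, lo x)) x ∂μ from
      (integral_indicator (f := fun x => g (x, hi x) - g (x, lo x)) (μ := μ) hD).symm]
  refine integral_congr_ae (Filter.Eventually.of_forall fun x => ?_)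
  by_cases hx : x ∈ D
  · rw [indicator_of_mem hx]
    have hfib := indicator_between_graphs_fibre (D := D) (lo := lo) (hi := hi) g' hx
    simp only [hS] at hfib ⊢
    rw [show (fun y => S.indicator g' (x, y)) = (Icc (lo x) (hi x)).indicator fun t => g' (x, t)
      from hfib, integral_indicator measurableSet_Icc, integral_Icc_eq_integral_Ioc,
      ← intervalIntegral.integral_of_le (hle x hx)]
    refine intervalIntegral.integral_eq_sub_of_hasDerivAt (f := fun s => g (x, s)) (fun t ht => ?_) ?_
    · rw [uIcc_of_le (hle x hx)] at ht
      exact hderiv x hx t ht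
    · refine ContinuousOn.intervalIntegrable ?_
      rw [uIcc_of_le (hle x hx)]
      exact hcont x hx
  · rw [indicator_of_notMem hx]
    have : (fun y => S.indicator g' (x, y)) = fun _ => 0 := by
      funext y
      rw [indicator_of_notMem]
      rintro ⟨h, -⟩
      exact hx h
    simp only [hS] at this ⊢
    rw [this, integral_zero]

/-- The same with the base written as a product-measure set integral over `D ×ˢ univ` restricted by
the graphs — convenient corollary: the volume version (`α = ℝ × ℝ`, Lebesgue), i.e. the
`e₃`-component of Gauss–Green for a vertically simple region of `ℝ³ ≅ (ℝ × ℝ) × ℝ`.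
[cite: EvansGariepy2015, Thm 5.16 (Gauss–Green), vertically simple case] -/
theorem setIntegral_deriv_between_graphs_volume {D : Set (ℝ × ℝ)} (hD : MeasurableSet D)
    {lo hi : ℝ × ℝ → ℝ} (hlo : Measurable lo) (hhi : Measurable hi) (hle : ∀ x ∈ D, lo x ≤ hi x)
    {g g' : (ℝ × ℝ) × ℝ → ℝ}
    (hderiv : ∀ x ∈ D, ∀ t ∈ Icc (lo x) (hi x), HasDerivAt (fun s => g (x, s)) (g' (x, t)) t)
    (hcont : ∀ x ∈ D, ContinuousOn (fun t => g' (x, t)) (Icc (lo x) (hi x)))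
    (hint : IntegrableOn g' {p : (ℝ × ℝ) × ℝ | p.1 ∈ D ∧ lo p.1 ≤ p.2 ∧ p.2 ≤ hi p.1} volume) :
    ∫ p in {p : (ℝ × ℝ) × ℝ | p.1 ∈ D ∧ lo p.1 ≤ p.2 ∧ p.2 ≤ hi p.1}, g' p =
      ∫ x in D, (g (x, hi x) - g (x, lo x)) := by
  have h := setIntegral_deriv_between_graphs (volume : Measure (ℝ × ℝ)) hD hlo hhi hle hderiv hcont
    (by simpa only [Measure.volume_eq_prod] using hint)
  simpa only [Measure.volume_eq_prod] using h

end Literature.MeasureTheory.Integral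

end
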